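import Summits.ValiantsHypothesis.ValiantsHypothesis.Theorems.SymPencilPerFourCoordinateRadical
import Summits.ValiantsHypothesis.ValiantsHypothesis.Theorems.SymPencilBoxFourEquality

/-!
# Route `SymPencil` — no JOINT family of four squares on a singular subspace containing the
# cross pair `E₁₀ + E₀₂`, `E₂₀ + E₀₁` (`--supports` stmt-ValiantsHypothesis-5674 `SdcSuperquadratic`;
# first V-side brick for the size-`27` cell `(11, 5, 4)`)

`SymPencilPerFourFiveDimFamilies` showed that the cross-type space
`V₅× = span {E₀₀, E₀₁, E₀₂, E₁₀, E₂₀} ⊆ Sing Z(per_4)` carries per-base-point AND per-direction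
families of four squares, so the `(11, 5, 4)` cell of the size-`27` kernel-package table is
invisible to the landed counting tools.  Here we show that the JOINT (bilinear) structure of the
kernel-package family does kill it:

**Theorem** (`not_jointFamily_four_of_cross_pair`).  Let `V` be ANY subspace of `K^{4×4}`
(characteristic `0`) containing `y⁰ = E₁₀ + E₀₂` and `y¹ = E₂₀ + E₀₁`.  Then there are no
`c : Fin 4 → K` and bilinear `β_k` (`k < 4`) with
`per_4 (u + s y) = e₀ + s e₁ + s² Σ_k c_k β_k(u, y)²` for all `u` and all `y ∈ V`.
In particular (`V₅× ∋ y⁰, y¹`) `V₅×` carries no joint family of four squares, although it carries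
both one-sided families (loc. cit.); and the same holds for every `V ⊇ {y⁰, y¹}`, e.g. the
`6`-space `V×` of `SymPencilPerFourSixDimJointSix` (which does carry SIX joint squares).

Proof.  Along the line `y(t) = y⁰ + t y¹ ∈ V` the `s²`-coefficient is, for every `u`,
`Q_t(u) = u₃₃ · w + v₃ n₃`, `w = u₂₁ + t u₂₂ + t u₁₁ + t² u₁₂`, `v₃ = u₂₃ + t u₁₃`,
`n₃ = u₃₁ + t u₃₂`; coefficient extraction and polarisation give
`Σ_k c_k β_k(u, y(t)) β_k(u′, y(t)) = ½ (Q_t(u+u′) − Q_t(u) − Q_t(u′))` for all `u, u′`.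
On the four test points `U = (e₃₃, e₂₁, e₂₃, e₃₁)` the Gram matrix is `½ J` with `J` the
permutation matrix of `(0 1)(2 3)`, so `𝔅 = (β_k(U_i, y(t)))_{ik}` satisfies `𝔅 D 𝔅ᵀ = ½ J`
(`D = diag c`), hence `𝔅` is invertible (`𝔅 · (2 D 𝔅ᵀ J) = 1`).  The vector
`z(t) = t² e₂₁ − e₁₂` is `Q_t`-orthogonal to all four `U_i` (and isotropic), so
`𝔅 · (c_k β_k(z(t), y(t)))_k = 0`, whence `c_k β_k(z(t), y(t)) = 0` for all `k, t`.  By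
bilinearity this is a cubic in `t` whose `t²`, `t³` coefficients are `c_k β_k(e₂₁, y⁰)`,
`c_k β_k(e₂₁, y¹)`; so both vanish, and at `t = 1` the polarisation identity with
`(u, u′) = (e₂₁, e₃₃)` reads `0 = ½ Q_1(e₂₁ + e₃₃) = ½` — contradiction.

Honest framing: a brick (negative for the would-be witnesses, positive towards the conjecture
«no `5`-dimensional singular `V` carries a joint family of four squares», crux workfile
`Cruxes/SdcSuperquadratic/TORIC-SIX.md` §X); `27 ≤ sdc(per₄) ≤ 29` unchanged, the crux
`SdcSuperquadratic` and `VP ≠ VNP` untouched.  No definitions, no named facts. [folklore]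
-/

noncomputable section

-- single-conjunct layout: Sub = Summit, duplicated namespace component intended
set_option linter.dupNamespace false

namespace Summit.ValiantsHypothesis.ValiantsHypothesis.Theorems.SymPencilPerFourCrossPairNoJoint

open MvPolynomial Module Matrix
open Literature.Computability.AlgebraicComplexity
open Summit.ValiantsHypothesis.ValiantsHypothesis.Theorems.SymPencilBoxFourEquality

variable {K : Type*} [Field K]

/-- Coefficient extraction: if `e₀ + e₁ s + A s² = f₀ + f₁ s + B s²` for all `s`
(characteristic `0`), then `A = B`. [folklore] -/
theorem coeff_two_eq_of_forall₂ [CharZero K] {e₀ e₁ A f₀ f₁ B : K}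
    (P : ∀ s : K, e₀ + s * e₁ + s ^ 2 * A = f₀ + s * f₁ + s ^ 2 * B) : A = B := by
  have h0 := P 0
  have h1 := P 1
  have h1' := P (-1)
  have h2 : (2 : K) * (A - B) = 0 := by linear_combination h1 + h1' - 2 * h0
  have h2' : (2 : K) ≠ 0 := two_ne_zero
  exact sub_eq_zero.1 ((mul_eq_zero.1 h2).resolve_left h2')

/-- Coefficient extraction for a cubic: if `A + B t + C t² + D t³ = 0` for all `t`
(characteristic `0`), then `C = 0` and `D = 0`. [folklore] -/
theorem coeff_cubic_eq_zero [CharZero K] {A B C D : K}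
    (P : ∀ t : K, A + t * B + t ^ 2 * C + t ^ 3 * D = 0) : C = 0 ∧ D = 0 := by
  have h0 := P 0
  have h1 := P 1
  have h1' := P (-1)
  have h2 := P 2
  have hC : (2 : K) * C = 0 := by linear_combination h1 + h1' - 2 * h0
  have hC' : C = 0 := (mul_eq_zero.1 hC).resolve_left two_ne_zero
  have hD : (6 : K) * D = 0 := by linear_combination h2 - 2 * h1 + h0 - hC
  have h6 : (6 : K) ≠ 0 := by norm_num
  exact ⟨hC', (mul_eq_zero.1 hD).resolve_left h6⟩

/-- **No joint family of four squares on a subspace containing `E₁₀ + E₀₂` and `E₂₀ + E₀₁`.**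
See the module docstring. [folklore] -/
theorem not_jointFamily_four_of_cross_pair [CharZero K] (V : Submodule K (Fin 4 × Fin 4 → K))
    (h₀ : (fun p : Fin 4 × Fin 4 => if p = (1, 0) then (1 : K) else if p = (0, 2) then 1 else 0) ∈ V)
    (h₁ : (fun p : Fin 4 × Fin 4 => if p = (2, 0) then (1 : K) else if p = (0, 1) then 1 else 0) ∈ V)
    (c : Fin 4 → K) (β : Fin 4 → ((Fin 4 × Fin 4 → K) →ₗ[K] (Fin 4 × Fin 4 → K) →ₗ[K] K)) :
    ¬ (∀ u : Fin 4 × Fin 4 → K, ∀ y ∈ V, ∃ e₀ e₁ : K, ∀ s : K,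
        eval (u + s • y) (perPoly (Fin 4) K) = e₀ + s * e₁ + s ^ 2 * ∑ k, c k * (β k u y) ^ 2) := by
  classical
  intro hj
  have hcases : ∀ i : Fin 4, i = 0 ∨ i = 1 ∨ i = 2 ∨ i = 3 := by decide
  -- the two generators and the line `y(t) = y₀ + t y₁`
  set y₀ : Fin 4 × Fin 4 → K :=
    fun p => if p = (1, 0) then (1 : K) else if p = (0, 2) then 1 else 0 with hy₀
  set y₁ : Fin 4 × Fin 4 → K :=
    fun p => if p = (2, 0) then (1 : K) else if p = (0, 1) then 1 else 0 with hy₁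
  have hyV : ∀ t : K, y₀ + t • y₁ ∈ V := fun t => V.add_mem h₀ (V.smul_mem t h₁)
  -- Fin 4 literal facts
  obtain ⟨f01, f02, f03, f10, f12, f13, f20, f21, f23, f30, f31, f32⟩ :
      (((0 : Fin 4) = 1) = False) ∧ (((0 : Fin 4) = 2) = False) ∧ (((0 : Fin 4) = 3) = False) ∧
      (((1 : Fin 4) = 0) = False) ∧ (((1 : Fin 4) = 2) = False) ∧ (((1 : Fin 4) = 3) = False) ∧
      (((2 : Fin 4) = 0) = False) ∧ (((2 : Fin 4) = 1) = False) ∧ (((2 : Fin 4) = 3) = False) ∧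
      (((3 : Fin 4) = 0) = False) ∧ (((3 : Fin 4) = 1) = False) ∧ (((3 : Fin 4) = 2) = False) := by
    refine ⟨?_, ?_, ?_, ?_, ?_, ?_, ?_, ?_, ?_, ?_, ?_, ?_⟩ <;> decide
  -- `succAbove` on `Fin 4` (rows / columns `0, 1, 2` only are needed)
  obtain ⟨e00, e01, e02, e10, e11, e12, e20, e21, e22⟩ :
      (0 : Fin 4).succAbove 0 = 1 ∧ (0 : Fin 4).succAbove 1 = 2 ∧ (0 : Fin 4).succAbove 2 = 3 ∧
      (1 : Fin 4).succAbove 0 = 0 ∧ (1 : Fin 4).succAbove 1 = 2 ∧ (1 : Fin 4).succAbove 2 = 3 ∧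
      (2 : Fin 4).succAbove 0 = 0 ∧ (2 : Fin 4).succAbove 1 = 1 ∧ (2 : Fin 4).succAbove 2 = 3 := by
    decide
  -- (A) the `s²`-coefficient `Q t u` along the line (an opaque name with its defining equation)
  obtain ⟨Q, hQ⟩ : ∃ Q : K → (Fin 4 × Fin 4 → K) → K, ∀ t u, Q t u =
      u (3, 3) * (u (2, 1) + t * u (2, 2) + t * u (1, 1) + t ^ 2 * u (1, 2)) +
        (u (2, 3) + t * u (1, 3)) * (u (3, 1) + t * u (3, 2)) := ⟨_, fun _ _ => rfl⟩
  have hA : ∀ (t : K) (u : Fin 4 × Fin 4 → K) (s : K),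
      eval (u + s • (y₀ + t • y₁)) (perPoly (Fin 4) K) =
        (Matrix.of fun i j => u (i, j)).permanent +
        s * (((Matrix.of fun i j => u (i, j)).submatrix (1 : Fin 4).succAbove
              (0 : Fin 4).succAbove).permanent +
            ((Matrix.of fun i j => u (i, j)).submatrix (0 : Fin 4).succAbove
              (2 : Fin 4).succAbove).permanent +
            t * ((Matrix.of fun i j => u (i, j)).submatrix (2 : Fin 4).succAbove
              (0 : Fin 4).succAbove).permanent +
            t * ((Matrix.of fun i j => u (i, j)).submatrix (0 : Fin 4).succAbove
              (1 : Fin 4).succAbove).permanent) +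
        s ^ 2 * Q t u := by
    intro t u s
    rw [eval_perPoly, Matrix.permanent_fin_four_row, Matrix.permanent_fin_four_row, hQ]
    simp only [Matrix.permanent_fin_three_row, Matrix.of_apply, Matrix.submatrix_apply, Pi.add_apply,
      Pi.smul_apply, smul_eq_mul, hy₀, hy₁, Prod.mk.injEq, e00, e01, e02, e10, e11, e12, e20, e21,
      e22, f01, f02, f10, f12, f20, f21, f30, f31, f32, and_true, and_false, if_true, if_false]
    ring
  -- (B) coefficient extraction
  have hB : ∀ (t : K) (u : Fin 4 × Fin 4 → K),
      c 0 * (β 0 u (y₀ + t • y₁)) ^ 2 + c 1 * (β 1 u (y₀ + t • y₁)) ^ 2 +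
        c 2 * (β 2 u (y₀ + t • y₁)) ^ 2 + c 3 * (β 3 u (y₀ + t • y₁)) ^ 2 = Q t u := by
    intro t u
    obtain ⟨e₀, e₁, he⟩ := hj u _ (hyV t)
    have h := coeff_two_eq_of_forall₂ (fun s => (he s).symm.trans (hA t u s))
    simpa only [Fin.sum_univ_four] using h
  -- (C) polarisation
  have hC : ∀ (t : K) (u u' : Fin 4 × Fin 4 → K),
      c 0 * β 0 u (y₀ + t • y₁) * β 0 u' (y₀ + t • y₁) +
        c 1 * β 1 u (y₀ + t • y₁) * β 1 u' (y₀ + t • y₁) +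
        c 2 * β 2 u (y₀ + t • y₁) * β 2 u' (y₀ + t • y₁) +
        c 3 * β 3 u (y₀ + t • y₁) * β 3 u' (y₀ + t • y₁) =
      2⁻¹ * (Q t (u + u') - Q t u - Q t u') := by
    intro t u u'
    have h := hB t (u + u')
    rw [map_add (β 0), map_add (β 1), map_add (β 2), map_add (β 3)] at h
    simp only [LinearMap.add_apply] at h
    have hu := hB t u
    have hu' := hB t u'
    linear_combination (2⁻¹ : K) * (h - hu - hu')
  -- the unit vectors, the four test vectors `U = (e₃₃, e₂₁, e₂₃, e₃₁)` and the Gram matrix `J`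
  obtain ⟨E, hE⟩ : ∃ E : Fin 4 × Fin 4 → (Fin 4 × Fin 4 → K), ∀ P p, E P p = if p = P then 1 else 0 :=
    ⟨fun P p => if p = P then 1 else 0, fun _ _ => rfl⟩
  obtain ⟨U, hU0, hU1, hU2, hU3⟩ : ∃ U : Fin 4 → (Fin 4 × Fin 4 → K),
      U 0 = E (3, 3) ∧ U 1 = E (2, 1) ∧ U 2 = E (2, 3) ∧ U 3 = E (3, 1) :=
    ⟨![E (3, 3), E (2, 1), E (2, 3), E (3, 1)], rfl, rfl, rfl, rfl⟩
  obtain ⟨J, hJ⟩ : ∃ J : Matrix (Fin 4) (Fin 4) K, ∀ i j, J i j =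
      if (i = 0 ∧ j = 1) ∨ (i = 1 ∧ j = 0) ∨ (i = 2 ∧ j = 3) ∨ (i = 3 ∧ j = 2) then 1 else 0 :=
    ⟨Matrix.of fun i j =>
      if (i = 0 ∧ j = 1) ∨ (i = 1 ∧ j = 0) ∨ (i = 2 ∧ j = 3) ∨ (i = 3 ∧ j = 2) then 1 else 0,
      fun _ _ => rfl⟩
  have hJJ : J * J = 1 := by
    ext i j
    rw [Matrix.mul_apply, Fin.sum_univ_four, Matrix.one_apply]
    rcases hcases i with rfl | rfl | rfl | rfl <;> rcases hcases j with rfl | rfl | rfl | rfl <;>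
      · simp only [hJ, f01, f02, f03, f10, f12, f13, f20, f21, f23, f30, f31, f32,
          and_true, and_false, or_true, or_false, if_true, if_false]
        ring
  -- Gram values on the test vectors: `½ (Q(Uᵢ+Uⱼ) - Q Uᵢ - Q Uⱼ) = ½ Jᵢⱼ`
  have hQU : ∀ (t : K) (i j : Fin 4),
      2⁻¹ * (Q t (U i + U j) - Q t (U i) - Q t (U j)) = 2⁻¹ * J i j := by
    intro t i j
    rcases hcases i with rfl | rfl | rfl | rfl <;> rcases hcases j with rfl | rfl | rfl | rfl <;>
      · simp only [hU0, hU1, hU2, hU3, hJ, hQ, hE, Pi.add_apply, Prod.mk.injEq, f01, f02, f03, f10,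
          f12, f13, f20, f21, f23, f30, f31, f32, and_true, and_false, or_true, or_false, if_true,
          if_false]
        ring
  -- the isotropic vector `z(t) = t² e₂₁ - e₁₂` is `Q_t`-orthogonal to the test vectors
  have hQz : ∀ (t : K) (i : Fin 4),
      2⁻¹ * (Q t (U i + (t ^ 2 • E (2, 1) - E (1, 2))) - Q t (U i) -
        Q t (t ^ 2 • E (2, 1) - E (1, 2))) = 0 := by
    intro t i
    rcases hcases i with rfl | rfl | rfl | rfl <;>
      · simp only [hU0, hU1, hU2, hU3, hQ, hE, Pi.add_apply, Pi.sub_apply, Pi.smul_apply,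
          smul_eq_mul, Prod.mk.injEq, f12, f13, f21, f23, f31, f32, and_true, and_false, if_true,
          if_false]
        ring
  -- (D) the matrix step at parameter `t`: `B D Bᵀ = ½ J`, so `B` is invertible and
  -- `c_k β_k(z(t), y(t)) = 0`
  have hD : ∀ (t : K) (k : Fin 4),
      c k * β k (t ^ 2 • E (2, 1) - E (1, 2)) (y₀ + t • y₁) = 0 := by
    intro t
    obtain ⟨B, hBdef⟩ : ∃ B : Matrix (Fin 4) (Fin 4) K, ∀ i k, B i k = β k (U i) (y₀ + t • y₁) :=
      ⟨Matrix.of fun i k => β k (U i) (y₀ + t • y₁), fun _ _ => rfl⟩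
    have hGram : B * Matrix.diagonal c * Bᵀ = (2⁻¹ : K) • J := by
      ext i j
      have hent : (B * Matrix.diagonal c * Bᵀ) i j =
          c 0 * β 0 (U i) (y₀ + t • y₁) * β 0 (U j) (y₀ + t • y₁) +
            c 1 * β 1 (U i) (y₀ + t • y₁) * β 1 (U j) (y₀ + t • y₁) +
            c 2 * β 2 (U i) (y₀ + t • y₁) * β 2 (U j) (y₀ + t • y₁) +
            c 3 * β 3 (U i) (y₀ + t • y₁) * β 3 (U j) (y₀ + t • y₁) := by
        rw [Matrix.mul_apply, Fin.sum_univ_four]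
        simp only [Matrix.mul_diagonal, Matrix.transpose_apply, hBdef]
        ring
      rw [hent, hC t (U i) (U j), Matrix.smul_apply, smul_eq_mul, hQU t i j]
    have hBR : B * ((2 : K) • (Matrix.diagonal c * Bᵀ * J)) = 1 := by
      rw [Matrix.mul_smul, ← Matrix.mul_assoc, ← Matrix.mul_assoc, hGram, Matrix.smul_mul,
        smul_smul, mul_inv_cancel₀ (two_ne_zero : (2 : K) ≠ 0), one_smul, hJJ]
    have hRB : ((2 : K) • (Matrix.diagonal c * Bᵀ * J)) * B = 1 := mul_eq_one_comm.1 hBR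
    -- the vector `v_k = c_k β_k(z, y)` is killed by `B`
    obtain ⟨v, hv⟩ : ∃ v : Fin 4 → K,
        ∀ k, v k = c k * β k (t ^ 2 • E (2, 1) - E (1, 2)) (y₀ + t • y₁) := ⟨_, fun _ => rfl⟩
    have hBv : B.mulVec v = 0 := by
      funext i
      have hent : B.mulVec v i =
          c 0 * β 0 (U i) (y₀ + t • y₁) * β 0 (t ^ 2 • E (2, 1) - E (1, 2)) (y₀ + t • y₁) +
            c 1 * β 1 (U i) (y₀ + t • y₁) * β 1 (t ^ 2 • E (2, 1) - E (1, 2)) (y₀ + t • y₁) +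
            c 2 * β 2 (U i) (y₀ + t • y₁) * β 2 (t ^ 2 • E (2, 1) - E (1, 2)) (y₀ + t • y₁) +
            c 3 * β 3 (U i) (y₀ + t • y₁) * β 3 (t ^ 2 • E (2, 1) - E (1, 2)) (y₀ + t • y₁) := by
        simp only [Matrix.mulVec, dotProduct, hBdef, hv, Fin.sum_univ_four]
        ring
      rw [hent, hC t (U i) _, Pi.zero_apply, hQz t i]
    have hv0 : v = 0 := by
      have h : ((2 : K) • (Matrix.diagonal c * Bᵀ * J) * B).mulVec v = v := by
        rw [hRB, Matrix.one_mulVec]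
      rw [← Matrix.mulVec_mulVec, hBv, Matrix.mulVec_zero] at h
      exact h.symm
    intro k
    rw [← hv k, hv0, Pi.zero_apply]
  -- (E) the cubic in `t`: its `t²` and `t³` coefficients vanish
  have hE2 : ∀ k : Fin 4, c k * β k (E (2, 1)) y₀ = 0 ∧ c k * β k (E (2, 1)) y₁ = 0 := by
    intro k
    refine coeff_cubic_eq_zero (A := -(c k * β k (E (1, 2)) y₀)) (B := -(c k * β k (E (1, 2)) y₁))
      fun t => ?_
    have h := hD t k
    simp only [map_sub, map_smul, map_add, LinearMap.sub_apply, LinearMap.smul_apply,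
      smul_eq_mul] at h
    linear_combination h
  -- (F) contradiction at `t = 1`
  have hF := hC 1 (E (2, 1)) (E (3, 3))
  have hJ10 : J 1 0 = 1 := by
    simp only [hJ, f10, f12, f13, f01, false_and, and_true, true_or, false_or, or_true,
      if_true]
  have hval := hQU 1 1 0
  rw [hU1, hU0, hJ10, mul_one] at hval
  have hsplit : ∀ k : Fin 4, c k * β k (E (2, 1)) (y₀ + (1 : K) • y₁) = 0 := fun k => by
    rw [one_smul, map_add, mul_add, (hE2 k).1, (hE2 k).2, add_zero]
  have h2 : (2⁻¹ : K) = 0 := by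
    rw [← hval, ← hF]
    linear_combination hsplit 0 * β 0 (E (3, 3)) (y₀ + (1 : K) • y₁) +
      hsplit 1 * β 1 (E (3, 3)) (y₀ + (1 : K) • y₁) +
      hsplit 2 * β 2 (E (3, 3)) (y₀ + (1 : K) • y₁) + hsplit 3 * β 3 (E (3, 3)) (y₀ + (1 : K) • y₁)
  exact (inv_ne_zero (two_ne_zero : (2 : K) ≠ 0)) h2

end Summit.ValiantsHypothesis.ValiantsHypothesis.Theorems.SymPencilPerFourCrossPairNoJoint

end
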